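import Mathlib
import Literature.Combinatorics.Additive.TripleProductProperty
import Literature.Combinatorics.Additive.ArithmeticRemovalProofs
import Literature.Combinatorics.Additive.TightTriangleRemovalSumMin
import Literature.Computability.AlgebraicComplexity.GroupTheoreticMatMulThmBProofs
import Literature.Barriers.MatrixMultiplication.TricoloredSumFreeBarrier

/-!
# Abelian sub-packing at the critical exponent (stub `stub_abelianSubPacking`)

Line `Sketch` (removal × Fekete) for the crux `AutomaticSTPPDesigns.RegularTowerGap`
(`stmt-MatrixMultiplication-7358`).

**Claim.** For every `η > 0` there is `N₀` such that every STPP family `(Aᵢ, Bᵢ, Cᵢ)_{i ∈ κ}` in a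
finite abelian group `H` with `|H| ≥ N₀` satisfies `∑ᵢ (|Aᵢ||Bᵢ||Cᵢ|)^{2/3} ≤ η |H|`.

**Proof.** Put `n = |H|`, `ε = η³/24`, and let `δ = δ(3, ε)` be the constant of Green's arithmetic
removal lemma (`Literature.Combinatorics.Additive.Green2005_1_5_holds`, PROVED in the tree);
`N₀ = ⌈1/δ²⌉₊`.  Reindex the family by `Fin N` (`AddSimultaneousTPP.comp`,
`isSTPP_iff_addSimultaneousTPP`).

* Removal (`sum_min_le_of_removal`).  Over the set `F` of blocks with all three sets nonempty put
  `D₁ = ⋃ (Aᵢ − Bᵢ)`, `D₂ = ⋃ (Bᵢ − Cᵢ)`, `D₃ = ⋃ (Cᵢ − Aᵢ)`.  The zero-sum triples of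
  `D₁ × D₂ × D₃` number at most `∑_{i∈F} |Aᵢ||Bᵢ||Cᵢ| ≤ n^{3/2} ≤ δ n²` (`card_triangles_le`,
  `sq_sum_card_mul_le`, `n ≥ 1/δ²`), so removal deletes `≤ ε n` elements from each `Dⱼ` and kills
  all zero-sum triples; the union `R` of the deleted elements meets every solution, whence Pratt's
  corrected count `sum_min_le_three_mul_card` gives
  `∑ᵢ min(|Aᵢ||Bᵢ|, |Bᵢ||Cᵢ|, |Cᵢ||Aᵢ|) ≤ 3|R| ≤ 9 ε n`.
* AM–GM (`three_mul_rpow_third_le_min`, `block_rpow_le`).  With `a = |Aᵢ|`, `b = |Bᵢ|`, `c = |Cᵢ|`,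
  `(abc)^{2/3} = ((ab)(bc)(ca))^{1/3} ≤ (μ·min(ab, bc, ca) + ν·(ab + bc + ca))/3` whenever
  `μ ν² = 1` (weighted AM–GM, `Real.geom_mean_le_arith_mean3_weighted`); take `μ = 4/η²`, `ν = η/2`.
* Summation (`sum_rpow_le_of_removal`).  Blocks outside `F` contribute `0`; over `F` the three
  packing bounds (`sum_card_mul_card_le_card` and `IsSTPP.rotate`) give `∑ (ab + bc + ca) ≤ 3n`, so
  `3 ∑ᵢ (abc)^{2/3} ≤ μ · 9 ε n + ν · 3 n = 3 η n`.

Supports item `stmt-MatrixMultiplication-7358`; no definitions, no named unproved facts.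
-/

-- the tree's namespace `Summit.MatrixMultiplication.MatrixMultiplication.…` repeats a component
-- by design
set_option linter.dupNamespace false

namespace Summit.MatrixMultiplication.MatrixMultiplication.Theorems.RegularTowerGap

open scoped BigOperators
open Literature.Combinatorics.Additive (AddSimultaneousTPP diffSet mem_diffSet card_triangles_le
  sq_sum_card_mul_le sum_card_mul_card_le_card sum_min_le_three_mul_card)
open Literature.Computability.AlgebraicComplexity (IsSTPP isSTPP_iff_addSimultaneousTPP)

namespace StubAbelianSubPacking

/-! ### AM–GM with a parameter -/

/-- **Weighted AM–GM**: for `u v w ≥ 0` and weights `μ, ν ≥ 0` with `μ ν² = 1`,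
`3 (uvw)^{1/3} ≤ μ u + ν v + ν w` (write `uvw = (μu)(νv)(νw)` and apply the AM–GM inequality
`Real.geom_mean_le_arith_mean3_weighted` with weights `1/3`). -/
theorem three_mul_rpow_third_le {u v w μ ν : ℝ} (hu : 0 ≤ u) (hv : 0 ≤ v) (hw : 0 ≤ w)
    (hμ : 0 ≤ μ) (hν : 0 ≤ ν) (hμν : μ * ν ^ 2 = 1) :
    3 * (u * v * w) ^ (1 / 3 : ℝ) ≤ μ * u + ν * v + ν * w := by
  have h1 : 0 ≤ μ * u := mul_nonneg hμ hu
  have h2 : 0 ≤ ν * v := mul_nonneg hν hv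
  have h3 : 0 ≤ ν * w := mul_nonneg hν hw
  have hag := Real.geom_mean_le_arith_mean3_weighted (by norm_num : (0 : ℝ) ≤ 1 / 3)
    (by norm_num : (0 : ℝ) ≤ 1 / 3) (by norm_num : (0 : ℝ) ≤ 1 / 3) h1 h2 h3 (by norm_num)
  have heq : u * v * w = (μ * u) * (ν * v) * (ν * w) := by
    calc u * v * w = (μ * ν ^ 2) * (u * v * w) := by rw [hμν, one_mul]
      _ = (μ * u) * (ν * v) * (ν * w) := by ring
  rw [heq, Real.mul_rpow (mul_nonneg h1 h2) h3, Real.mul_rpow h1 h2]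
  linarith

/-- **AM–GM against the minimum**: for `u v w ≥ 0` and `μ, ν ≥ 0` with `μ ν² = 1`,
`3 (uvw)^{1/3} ≤ μ · min(u, v, w) + ν · (u + v + w)` (put the weight `μ` on the smallest factor in
`three_mul_rpow_third_le`). -/
theorem three_mul_rpow_third_le_min {u v w μ ν : ℝ} (hu : 0 ≤ u) (hv : 0 ≤ v) (hw : 0 ≤ w)
    (hμ : 0 ≤ μ) (hν : 0 ≤ ν) (hμν : μ * ν ^ 2 = 1) :
    3 * (u * v * w) ^ (1 / 3 : ℝ) ≤ μ * min u (min v w) + ν * (u + v + w) := by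
  rcases le_total u (min v w) with h | h
  · rw [min_eq_left h]
    have key := three_mul_rpow_third_le hu hv hw hμ hν hμν
    linarith [mul_nonneg hν hu]
  · rw [min_eq_right h]
    rcases le_total v w with h' | h'
    · rw [min_eq_left h', show u * v * w = v * w * u by ring]
      have key := three_mul_rpow_third_le hv hw hu hμ hν hμν
      linarith [mul_nonneg hν hv]
    · rw [min_eq_right h', show u * v * w = w * u * v by ring]
      have key := three_mul_rpow_third_le hw hu hv hμ hν hμν
      linarith [mul_nonneg hν hw]

/-- **The per-block bound**: for naturals `a b c` and `μ, ν ≥ 0` with `μ ν² = 1`,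
`3 (abc)^{2/3} ≤ μ · min(ab, bc, ca) + ν · (ab + bc + ca)`, since
`(abc)^{2/3} = ((ab)(bc)(ca))^{1/3}`. -/
theorem block_rpow_le (a b c : ℕ) {μ ν : ℝ} (hμ : 0 ≤ μ) (hν : 0 ≤ ν) (hμν : μ * ν ^ 2 = 1) :
    3 * (((a * b * c : ℕ)) : ℝ) ^ ((2 : ℝ) / 3) ≤
      μ * ((min (a * b) (min (b * c) (c * a)) : ℕ) : ℝ) +
        ν * ((a * b + b * c + c * a : ℕ) : ℝ) := by
  have hx : (0 : ℝ) ≤ ((a * b * c : ℕ) : ℝ) := Nat.cast_nonneg _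
  rw [show ((2 : ℝ) / 3) = ((2 : ℕ) : ℝ) * (1 / 3) by norm_num, Real.rpow_natCast_mul hx 2 (1 / 3)]
  have hsq : ((a * b * c : ℕ) : ℝ) ^ 2 =
      ((a * b : ℕ) : ℝ) * ((b * c : ℕ) : ℝ) * ((c * a : ℕ) : ℝ) := by
    push_cast; ring
  rw [hsq, Nat.cast_min, Nat.cast_min, Nat.cast_add, Nat.cast_add]
  exact three_mul_rpow_third_le_min (Nat.cast_nonneg _) (Nat.cast_nonneg _) (Nat.cast_nonneg _)
    hμ hν hμν

/-! ### The removal step -/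

/-- **Removal ⇒ small sum of minima.** Let `G` be a finite abelian group of order `n ≥ 1/δ²` in
which the conclusion of the arithmetic removal lemma holds for triples with the constants `(ε, δ)`,
and let `(Aᵢ, Bᵢ, Cᵢ)` be an STPP family.  Over the blocks with all three sets nonempty, the
zero-sum triples of `(⋃ Aᵢ − Bᵢ) × (⋃ Bᵢ − Cᵢ) × (⋃ Cᵢ − Aᵢ)` number at most
`∑ |Aᵢ||Bᵢ||Cᵢ| ≤ n^{3/2} ≤ δ n²` (`card_triangles_le`, `sq_sum_card_mul_le`); removal deletes
`≤ ε n` elements from each of the three sets and the union `R` of the deletions meets every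
solution, so
`∑ᵢ min(|Aᵢ||Bᵢ|, |Bᵢ||Cᵢ|, |Cᵢ||Aᵢ|) ≤ 3|R| ≤ 9 ε n` (`sum_min_le_three_mul_card`). -/
theorem sum_min_le_of_removal {G : Type} [AddCommGroup G] [Fintype G] [DecidableEq G]
    {ε δ : ℝ} (hδ : 0 < δ)
    (hrem : ∀ D : Fin 3 → Finset G,
      ((((Fintype.piFinset D).filter fun a => ∑ j, a j = 0).card : ℕ) : ℝ) ≤
          δ * (Fintype.card G : ℝ) ^ 2 →
        ∃ D' : Fin 3 → Finset G, (∀ j, D' j ⊆ D j) ∧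
          (∀ j, (((D j \ D' j).card : ℕ) : ℝ) ≤ ε * (Fintype.card G : ℝ)) ∧
          ∀ a ∈ Fintype.piFinset D', ∑ j, a j ≠ 0)
    (hn : 1 / δ ^ 2 ≤ (Fintype.card G : ℝ))
    {N : ℕ} {A B C : Fin N → Finset G} (hS : IsSTPP A B C) :
    ∑ i, ((min ((A i).card * (B i).card) (min ((B i).card * (C i).card) ((C i).card * (A i).card)) :
      ℕ) : ℝ) ≤ 9 * ε * Fintype.card G := by
  set n := Fintype.card G with hn_def
  set F : Finset (Fin N) :=
    Finset.univ.filter fun i => (A i).Nonempty ∧ (B i).Nonempty ∧ (C i).Nonempty with hF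
  have hFA : ∀ i ∈ F, (A i).Nonempty := fun i hi => ((Finset.mem_filter.1 hi).2).1
  have hFB : ∀ i ∈ F, (B i).Nonempty := fun i hi => ((Finset.mem_filter.1 hi).2).2.1
  have hFC : ∀ i ∈ F, (C i).Nonempty := fun i hi => ((Finset.mem_filter.1 hi).2).2.2
  set D₁ : Finset G := F.biUnion fun i => diffSet (A i) (B i) with hD₁
  set D₂ : Finset G := F.biUnion fun i => diffSet (B i) (C i) with hD₂
  set D₃ : Finset G := F.biUnion fun i => diffSet (C i) (A i) with hD₃
  -- few zero-sum triples: they inject into the solutions counted by `card_triangles_le`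
  have hcount : ((Fintype.piFinset ![D₁, D₂, D₃]).filter fun a => ∑ j, a j = 0).card ≤
      ∑ i ∈ F, (A i).card * (B i).card * (C i).card := by
    refine le_trans ?_ (card_triangles_le hS F)
    refine Finset.card_le_card_of_injOn (fun a => (a 0, a 1, a 2)) ?_ ?_
    · intro a ha
      obtain ⟨hmem, hsum⟩ := Finset.mem_filter.1 (Finset.mem_coe.1 ha)
      rw [Fintype.mem_piFinset] at hmem
      rw [Fin.sum_univ_three] at hsum
      have h0 : a 0 ∈ D₁ := hmem 0
      have h1 : a 1 ∈ D₂ := hmem 1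
      have h2 : a 2 ∈ D₃ := hmem 2
      exact Finset.mem_coe.2 (Finset.mem_filter.2
        ⟨Finset.mem_product.2 ⟨h0, Finset.mem_product.2 ⟨h1, h2⟩⟩, hsum⟩)
    · intro a _ a' _ h
      simp only [Prod.mk.injEq] at h
      funext j
      fin_cases j
      exacts [h.1, h.2.1, h.2.2]
  -- `∑_{i ∈ F} |Aᵢ||Bᵢ||Cᵢ| ≤ n^{3/2} ≤ δ n²`
  have hSδ : ((∑ i ∈ F, (A i).card * (B i).card * (C i).card : ℕ) : ℝ) ≤ δ * (n : ℝ) ^ 2 := by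
    have h1 : ((∑ i ∈ F, (A i).card * (B i).card * (C i).card : ℕ) : ℝ) ^ 2 ≤ (n : ℝ) ^ 3 := by
      exact_mod_cast sq_sum_card_mul_le hS hFA hFB hFC
    have hδn : 1 ≤ δ ^ 2 * n := by
      rw [div_le_iff₀ (by positivity)] at hn
      linarith [mul_comm (n : ℝ) (δ ^ 2)]
    have h2 : (n : ℝ) ^ 3 ≤ (δ * (n : ℝ) ^ 2) ^ 2 := by
      calc (n : ℝ) ^ 3 = (n : ℝ) ^ 3 * 1 := by ring
        _ ≤ (n : ℝ) ^ 3 * (δ ^ 2 * n) := mul_le_mul_of_nonneg_left hδn (by positivity)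
        _ = (δ * (n : ℝ) ^ 2) ^ 2 := by ring
    exact (pow_le_pow_iff_left₀ (Nat.cast_nonneg _) (by positivity) two_ne_zero).1 (h1.trans h2)
  -- removal
  obtain ⟨D', -, hdel, hno⟩ := hrem ![D₁, D₂, D₃] ((Nat.cast_le.2 hcount).trans hSδ)
  have hd0 : (((D₁ \ D' 0).card : ℕ) : ℝ) ≤ ε * n := by simpa only [Matrix.cons_val] using hdel 0
  have hd1 : (((D₂ \ D' 1).card : ℕ) : ℝ) ≤ ε * n := by simpa only [Matrix.cons_val] using hdel 1
  have hd2 : (((D₃ \ D' 2).card : ℕ) : ℝ) ≤ ε * n := by simpa only [Matrix.cons_val] using hdel 2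
  set R : Finset G := (D₁ \ D' 0) ∪ (D₂ \ D' 1) ∪ (D₃ \ D' 2) with hR_def
  have hRcard : ((R.card : ℕ) : ℝ) ≤ 3 * (ε * n) := by
    have h : R.card ≤ (D₁ \ D' 0).card + (D₂ \ D' 1).card + (D₃ \ D' 2).card :=
      (Finset.card_union_le _ _).trans (Nat.add_le_add_right (Finset.card_union_le _ _) _)
    have h' : ((R.card : ℕ) : ℝ) ≤ (((D₁ \ D' 0).card : ℕ) : ℝ) + (((D₂ \ D' 1).card : ℕ) : ℝ) +
        (((D₃ \ D' 2).card : ℕ) : ℝ) := by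
      exact_mod_cast h
    linarith
  -- `R` meets every solution with coordinates in `D₁, D₂, D₃`
  have hRgood : ∀ x ∈ D₁, x ∉ R → ∀ y ∈ D₂, y ∉ R → ∀ z ∈ D₃, z ∉ R → x + y + z ≠ 0 := by
    intro x hx hxR y hy hyR z hz hzR hsum
    have kx : x ∈ D' 0 := by_contra fun hc =>
      hxR (Finset.mem_union_left _ (Finset.mem_union_left _ (Finset.mem_sdiff.2 ⟨hx, hc⟩)))
    have ky : y ∈ D' 1 := by_contra fun hc =>
      hyR (Finset.mem_union_left _ (Finset.mem_union_right _ (Finset.mem_sdiff.2 ⟨hy, hc⟩)))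
    have kz : z ∈ D' 2 := by_contra fun hc =>
      hzR (Finset.mem_union_right _ (Finset.mem_sdiff.2 ⟨hz, hc⟩))
    refine hno ![x, y, z] (Fintype.mem_piFinset.2 fun j => ?_) ?_
    · fin_cases j
      exacts [kx, ky, kz]
    · rw [Fin.sum_univ_three]
      show x + y + z = 0
      exact hsum
  have hmin : ∑ i, ((min ((A i).card * (B i).card)
      (min ((B i).card * (C i).card) ((C i).card * (A i).card)) : ℕ) : ℝ) ≤ 3 * (R.card : ℝ) := by
    exact_mod_cast sum_min_le_three_mul_card hS R hRgood
  linarith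

/-! ### Summation over the blocks -/

/-- **Sub-packing for `Fin N`-indexed STPP families.** If the removal conclusion holds in `G` with
constants `(ε, δ)`, `ε = η³/24`, and `|G| ≥ 1/δ²`, then every STPP family `(Aᵢ, Bᵢ, Cᵢ)_{i < N}`
in `G` has `∑ᵢ (|Aᵢ||Bᵢ||Cᵢ|)^{2/3} ≤ η |G|`: blocks with an empty set contribute `0`; on the others
`3 (abc)^{2/3} ≤ μ min(ab, bc, ca) + ν (ab + bc + ca)` with `μ = 4/η²`, `ν = η/2` (`block_rpow_le`),
the minima sum to `≤ 9 ε n` (`sum_min_le_of_removal`) and `∑ (ab + bc + ca) ≤ 3n` by the three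
packing bounds, and `μ · 9 ε n + ν · 3 n = 3 η n`. -/
theorem sum_rpow_le_of_removal {G : Type} [AddCommGroup G] [Fintype G] [DecidableEq G]
    {η ε δ : ℝ} (hη : 0 < η) (hε : ε = η ^ 3 / 24) (hδ : 0 < δ)
    (hrem : ∀ D : Fin 3 → Finset G,
      ((((Fintype.piFinset D).filter fun a => ∑ j, a j = 0).card : ℕ) : ℝ) ≤
          δ * (Fintype.card G : ℝ) ^ 2 →
        ∃ D' : Fin 3 → Finset G, (∀ j, D' j ⊆ D j) ∧
          (∀ j, (((D j \ D' j).card : ℕ) : ℝ) ≤ ε * (Fintype.card G : ℝ)) ∧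
          ∀ a ∈ Fintype.piFinset D', ∑ j, a j ≠ 0)
    (hn : 1 / δ ^ 2 ≤ (Fintype.card G : ℝ))
    {N : ℕ} {A B C : Fin N → Finset G} (hS : IsSTPP A B C) :
    ∑ i, (((A i).card * (B i).card * (C i).card : ℕ) : ℝ) ^ ((2 : ℝ) / 3) ≤ η * Fintype.card G := by
  set n := Fintype.card G with hn_def
  -- the weights `μ = 4/η²`, `ν = η/2`
  obtain ⟨μ, hμ_def⟩ : ∃ μ : ℝ, μ = 4 / η ^ 2 := ⟨_, rfl⟩
  obtain ⟨ν, hν_def⟩ : ∃ ν : ℝ, ν = η / 2 := ⟨_, rfl⟩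
  have hμ : 0 ≤ μ := by rw [hμ_def]; positivity
  have hν : 0 ≤ ν := by rw [hν_def]; positivity
  have hμν : μ * ν ^ 2 = 1 := by rw [hμ_def, hν_def]; field_simp; ring
  have hfin : μ * (9 * ε * n) + ν * (3 * n) = 3 * (η * n) := by
    rw [hμ_def, hν_def, hε]; field_simp; ring
  -- the blocks with all three sets nonempty
  set F : Finset (Fin N) :=
    Finset.univ.filter fun i => (A i).Nonempty ∧ (B i).Nonempty ∧ (C i).Nonempty with hF
  have hFA : ∀ i ∈ F, (A i).Nonempty := fun i hi => ((Finset.mem_filter.1 hi).2).1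
  have hFB : ∀ i ∈ F, (B i).Nonempty := fun i hi => ((Finset.mem_filter.1 hi).2).2.1
  have hFC : ∀ i ∈ F, (C i).Nonempty := fun i hi => ((Finset.mem_filter.1 hi).2).2.2
  -- the minima: `≤ 9 ε n`
  have h3 : ∑ i ∈ F, ((min ((A i).card * (B i).card)
      (min ((B i).card * (C i).card) ((C i).card * (A i).card)) : ℕ) : ℝ) ≤ 9 * ε * n :=
    (Finset.sum_le_sum_of_subset_of_nonneg (Finset.subset_univ F)
      fun i _ _ => Nat.cast_nonneg _).trans (sum_min_le_of_removal hδ hrem hn hS)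
  -- the pair products: `≤ 3 n` by the three packing bounds
  have h4 : ∑ i ∈ F, (((A i).card * (B i).card + (B i).card * (C i).card + (C i).card * (A i).card :
      ℕ) : ℝ) ≤ 3 * n := by
    have hAB : ∑ i ∈ F, (A i).card * (B i).card ≤ n := sum_card_mul_card_le_card hS hFC
    have hBC : ∑ i ∈ F, (B i).card * (C i).card ≤ n := sum_card_mul_card_le_card hS.rotate hFA
    have hCA : ∑ i ∈ F, (C i).card * (A i).card ≤ n :=
      sum_card_mul_card_le_card hS.rotate.rotate hFB
    have hnat : ∑ i ∈ F, ((A i).card * (B i).card + (B i).card * (C i).card +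
        (C i).card * (A i).card) ≤ 3 * n := by
      rw [Finset.sum_add_distrib, Finset.sum_add_distrib]
      omega
    exact_mod_cast hnat
  -- blocks outside `F` contribute `0`
  have hzero : ∀ i ∈ (Finset.univ : Finset (Fin N)), i ∉ F →
      (((A i).card * (B i).card * (C i).card : ℕ) : ℝ) ^ ((2 : ℝ) / 3) = 0 := by
    intro i _ hi
    rw [hF, Finset.mem_filter, not_and] at hi
    have hi' := hi (Finset.mem_univ i)
    simp only [not_and_or, Finset.not_nonempty_iff_eq_empty] at hi'
    have h0 : (A i).card * (B i).card * (C i).card = 0 := by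
      rcases hi' with hA | hB | hC
      · rw [hA, Finset.card_empty, zero_mul, zero_mul]
      · rw [hB, Finset.card_empty, mul_zero, zero_mul]
      · rw [hC, Finset.card_empty, mul_zero]
    rw [h0, Nat.cast_zero, Real.zero_rpow (by norm_num)]
  rw [← Finset.sum_subset (Finset.subset_univ F) hzero]
  -- the per-block bound, summed over `F`
  have h1 : ∑ i ∈ F, 3 * (((A i).card * (B i).card * (C i).card : ℕ) : ℝ) ^ ((2 : ℝ) / 3) ≤
      ∑ i ∈ F, (μ * ((min ((A i).card * (B i).card)
        (min ((B i).card * (C i).card) ((C i).card * (A i).card)) : ℕ) : ℝ) +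
        ν * (((A i).card * (B i).card + (B i).card * (C i).card + (C i).card * (A i).card :
          ℕ) : ℝ)) :=
    Finset.sum_le_sum fun i _ => block_rpow_le _ _ _ hμ hν hμν
  rw [Finset.sum_add_distrib, ← Finset.mul_sum, ← Finset.mul_sum, ← Finset.mul_sum] at h1
  have h5 := mul_le_mul_of_nonneg_left h3 hμ
  have h6 := mul_le_mul_of_nonneg_left h4 hν
  linarith

end StubAbelianSubPacking

open StubAbelianSubPacking in
/-- **Stub `stub_abelianSubPacking` — abelian sub-packing at the critical exponent.** For every
`η > 0` there is `N₀` such that every STPP family `(Aᵢ, Bᵢ, Cᵢ)_{i ∈ κ}` in a finite abelian group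
`H` with `|H| ≥ N₀` satisfies `∑ᵢ (|Aᵢ||Bᵢ||Cᵢ|)^{2/3} ≤ η |H|`.  Green's arithmetic removal lemma
(`Green2005_1_5_holds`, `k = 3`, `ε = η³/24`) supplies `δ`; take `N₀ = ⌈1/δ²⌉₊`, reindex the family
by `Fin |κ|` (`AddSimultaneousTPP.comp`, `isSTPP_iff_addSimultaneousTPP`) and apply
`sum_rpow_le_of_removal`. -/
theorem stub_abelianSubPacking :
    ∀ η : ℝ, 0 < η → ∃ N₀ : ℕ, ∀ (H : Type) [AddCommGroup H] [Fintype H] [DecidableEq H],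
      N₀ ≤ Fintype.card H → ∀ (κ : Type) [Fintype κ] (A B C : κ → Finset H),
        AddSimultaneousTPP A B C →
          ∑ i, (((A i).card * (B i).card * (C i).card : ℕ) : ℝ) ^ ((2 : ℝ) / 3) ≤
            η * Fintype.card H := by
  intro η hη
  obtain ⟨δ, hδ, hrem⟩ :=
    Literature.Combinatorics.Additive.Green2005_1_5_holds 3 le_rfl (η ^ 3 / 24) (by positivity)
  refine ⟨⌈1 / δ ^ 2⌉₊, ?_⟩
  intro H _ _ _ hH κ _ A B C hT
  have hn : 1 / δ ^ 2 ≤ (Fintype.card H : ℝ) := (Nat.le_ceil _).trans (by exact_mod_cast hH)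
  -- reindex along `Fin |κ| ≃ κ`
  set e : Fin (Fintype.card κ) ≃ κ := (Fintype.equivFin κ).symm with he
  have hS : IsSTPP (A ∘ e) (B ∘ e) (C ∘ e) :=
    (isSTPP_iff_addSimultaneousTPP _ _ _).2 (hT.comp e.injective)
  have key := sum_rpow_le_of_removal (ε := η ^ 3 / 24) hη rfl hδ
    (fun D hD => hrem H D (hD.trans_eq (by norm_num))) hn hS
  calc ∑ i, (((A i).card * (B i).card * (C i).card : ℕ) : ℝ) ^ ((2 : ℝ) / 3)
      = ∑ j, ((((A ∘ e) j).card * ((B ∘ e) j).card * ((C ∘ e) j).card : ℕ) : ℝ) ^ ((2 : ℝ) / 3) :=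
        (e.sum_comp
          (fun i => (((A i).card * (B i).card * (C i).card : ℕ) : ℝ) ^ ((2 : ℝ) / 3))).symm
    _ ≤ η * Fintype.card H := key

end Summit.MatrixMultiplication.MatrixMultiplication.Theorems.RegularTowerGap
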